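import Summits.AtomisticToContinuum.BoseEinsteinCondensation.Theorems.PeriodicIRBound.Negative.GroundOccupation
import Literature.MathematicalPhysics.QuantumManyBody.PeriodicBoseGasMomentumSector
import Summits.AtomisticToContinuum.BoseEinsteinCondensation.Theorems.PeriodicIRBound.Negative.LoadBearing
import Summits.AtomisticToContinuum.BoseEinsteinCondensation.Theorems.PeriodicIRBound.Negative.HardCoreScope

/-!
# Negative lemmas for crux `PeriodicIRBound` (stmt-AtomisticToContinuum-3972) — line
`linear-ph-floor-wagner`, stub 6b (`stub_hardCoreWagnerFeynman`): the density threshold is load-bearing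

Supports (does not close) stmt-AtomisticToContinuum-3972, route `BECGroundStateSOS`. Deep-refute pass
(gen 2) on the lead's reshaped skeleton (8 stubs; statements in the Defs module
`Theorems/BECGroundStateSOSPeriodicIRBoundDefs.lean`, whose `HardCoreWagnerFeynmanWith` is copied VERBATIM below so that
this file imports only landed Negative files). All `sorry`-free.

The reshaped non-integrable half rests on `HardCoreWagnerFeynmanBound`
(`∀ v` admissible with `∫ v = ⊤`, `∀ C > 0 ∃ A > 0 ∃ ρ₁ > 0, HardCoreWagnerFeynmanWith v C A ρ₁`): along the
thermodynamic boxes `L_N = (N/ρ)^{1/3}`, for `ρ < ρ₁` and eventually in `N`, whenever the particle–hole sector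
sum at `p = 2πk/L_N` exceeds `2E₀^per(N,L_N)` by `θ ≥ 0`, the ground-state occupation obeys
`γ_N(k)·θ ≤ A(‖p‖² + ρ)`. Unlike the integrable twin `WagnerFeynmanWith v A` (stub 5b: every `N ≥ 2`, every
`L > 0`, guarded by `E₀^per ≠ ⊤`), it carries a density threshold `ρ₁` and no finiteness guard.

* `le_groundOccupation_of_eq_top` — if `E₀^per(N,L) = ⊤` then EVERY state is a near-minimiser for every
  slack, so `γ_N(k) ≥ n_k(Ψ)` for every admissible `Ψ`; with the boosted condensate (`twoMode 1`),
  `γ_N(k) ≥ N` (`natCast_le_groundOccupation_of_eq_top`).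
* `periodicEnergy_hardCore_top_of_le` — jamming in the box `L_N = (N/64)^{1/3}` persists for every particle
  number `M ≥ N ≥ 64` (pigeonhole of `CorrectorClosure.Negative.periodicEnergy_hardCore_eq_top`), whence
  `E₀^per(hardCore; N, L_N) = E₀^per(hardCore; N+1, L_N) = ⊤` and every `(N+1)`-body momentum sector of that
  box has energy `⊤`.
* `not_hardCoreWagnerFeynmanWith_hardCore` — **MUTATION (stub 6b): for the admissible hard core of radius 1,
  `HardCoreWagnerFeynmanWith hardCore C A ρ₁` is FALSE for every window constant `C > 0`, every `A` and every
  threshold `ρ₁ > 64`**: at `ρ = 64` the particle–hole hypothesis `2·⊤ + θ ≤ ⊤` holds for EVERY `θ`, while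
  `γ_N(e₁) ≥ N`, so `γ·θ ≤ A(‖p‖² + ρ)` fails for large `θ`. Hence the `∃ ρ₁` of `HardCoreWagnerFeynmanBound`
  must be chosen below close packing (`hardCoreWagnerFeynmanWith_hardCore_threshold_le`), the bound cannot be
  restated at all densities (`not_hardCoreWagnerFeynmanAllDensities`), and the fixed-box shape of stub 5b
  transplanted to hard cores WITHOUT its guard `E₀^per ≠ ⊤` is false (`not_hardCoreWagnerFeynmanFixedBox`):
  for non-integrable `v` the finiteness of `E₀^per(N, L_N)` (Ruelle, `ρ < ρ₁(v)`) is exactly what the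
  threshold buys. (Companion of `AeZeroPotential.not_zeroMomentumGapFor_hardCore`, same jamming mechanism.)
* `groundOccupation_eq_zero_of_channel_top` — NORMAL FORM of the corner: under the predicate, a window mode whose particle
  or hole sector has energy `⊤` must have `γ_N(k) = 0` (`eq_zero_of_forall_mul_ofReal_le`); harmless at low density, decisive
  at jamming.
* Consistency remark (no new object): the free gas is fully condensed in γ-form (`γ^free_N(k) = 0` for `k ≠ 0`, landed
  `LinearFloorTargets.groundOccupation_zero_eq_zero`), so it satisfies the predicate with EVERY `C, A, ρ₁` — as for stub 5b,
  no free or a.e.-free instance can probe the constants of stub 6b; a kill needs an occupation LOWER bound for an interacting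
  hard-core gas.
-/

noncomputable section

open MeasureTheory Filter
open scoped ENNReal NNReal BigOperators

namespace Summit.AtomisticToContinuum.BoseEinsteinCondensation.Theorems.PeriodicIRBound.Negative

namespace HardCoreThreshold

open Literature.MathematicalPhysics.QuantumManyBody.BoseGas
open Summit.AtomisticToContinuum.BoseEinsteinCondensation.Theorems.GaussianDominationCan.Negative
  (e0_ne_zero)

open Summit.AtomisticToContinuum.BoseEinsteinCondensation.Theorems.CorrectorClosure.Negative
  (hardCore isRepulsiveFiniteRange_hardCore periodicEnergy_hardCore_eq_top)
variable {L : ℝ} {N : ℕ}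

/-- **Stub 6b's per-potential predicate** — VERBATIM copy of
`Summit.AtomisticToContinuum.BoseEinsteinCondensation.Cruxes.PeriodicIRBound.LinearPhFloorWagner.HardCoreWagnerFeynmanWith`
(landed Defs module `Theorems/BECGroundStateSOSPeriodicIRBoundDefs.lean`, which this file deliberately does not import, like
its sibling Negative files): the hard-core (dressed) Wagner–Feynman moment bound with window constant `C`, moment constant `A`
and density threshold `ρ₁`, along `L_N = (N/ρ)^{1/3}` — `γ_N(k)·θ ≤ A(‖p‖² + ρ)` whenever
`2E₀^per(N,L_N) + θ ≤ E^per_{N+1}(p;L_N) + E^per_{N-1}(p;L_N)`, `p = 2πk/L_N`, `‖p‖² ≤ Cρ`. A statement of the line's proof plan,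
not a result in print. -/
def HardCoreWagnerFeynmanWith (v : ℝ → ℝ≥0∞) (C A ρ₁ : ℝ) : Prop :=
  ∀ ρ : ℝ, 0 < ρ → ρ < ρ₁ → ∀ᶠ N : ℕ in atTop, ∀ k : Fin 3 → ℤ, k ≠ 0 →
    ‖latticeVec (2 * Real.pi / sideLength ρ N) k‖ ^ 2 ≤ C * ρ → ∀ θ : ℝ, 0 ≤ θ →
      2 * periodicGroundStateEnergy v N (sideLength ρ N) + ENNReal.ofReal θ ≤
          momentumSectorEnergy v (N + 1) (sideLength ρ N) (latticeVec (2 * Real.pi / sideLength ρ N) k) +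
            momentumSectorEnergy v (N - 1) (sideLength ρ N) (latticeVec (2 * Real.pi / sideLength ρ N) k) →
      groundOccupation v N (sideLength ρ N) k * ENNReal.ofReal θ ≤
        ENNReal.ofReal (A * (‖latticeVec (2 * Real.pi / sideLength ρ N) k‖ ^ 2 + ρ))

/-! ## §1 Ground-state occupations when the ground-state energy is `⊤` -/

/-- If `E₀^per(N,L) = ⊤` then every admissible state is a `δ`-near-minimiser for every `δ`, so the
ground-state occupation dominates the occupation of EVERY state. [folklore] -/
theorem le_groundOccupation_of_eq_top {v : ℝ → ℝ≥0∞} (hE : periodicGroundStateEnergy v N L = ⊤)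
    (Ψ : PeriodicTrialState N L) (k : Fin 3 → ℤ) :
    cellOccupation N L (planeWaveMode L k) Ψ.ψ ≤ groundOccupation v N L k := by
  unfold groundOccupation
  refine le_iInf₂ fun δ _ => ?_
  exact le_iSup₂_of_le (f := fun (Φ : PeriodicTrialState N L)
      (_ : periodicEnergy v Φ ≤ periodicGroundStateEnergy v N L + δ) =>
        cellOccupation N L (planeWaveMode L k) Φ.ψ) Ψ (by rw [hE, top_add]; exact le_top) le_rfl

/-- With `E₀^per = ⊤`, the boosted condensate `L^{-3N/2}∏ⱼ e_k(xⱼ)` (`twoMode 1`) shows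
`γ_N(k) ≥ N` for every `k ≠ 0` (`N = m + 1 ≥ 1`). [folklore] -/
theorem natCast_le_groundOccupation_of_eq_top {v : ℝ → ℝ≥0∞} {m : ℕ} (hL : 0 < L)
    (hE : periodicGroundStateEnergy v (m + 1) L = ⊤) {k : Fin 3 → ℤ} (hk : k ≠ 0) :
    ((m + 1 : ℕ) : ℝ≥0∞) ≤ groundOccupation v (m + 1) L k := by
  have h := le_groundOccupation_of_eq_top hE (twoMode m hL hk 1 zero_le_one le_rfl) k
  rwa [cellOccupation_twoMode hL hk zero_le_one le_rfl, mul_one, ENNReal.ofReal_natCast] at h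

/-! ## §2 Jamming in the box `L_N = (N/64)^{1/3}` for every particle number `M ≥ N` -/

/-- Above close packing (`ρ = 64`, hard core of radius `1`): in the torus of side `L_N = (N/64)^{1/3}`,
`N ≥ 64`, every periodic `M`-body state with `M ≥ N` particles has energy `⊤` (pigeonhole: `⌈2L_N⌉³ < N ≤ M`
sub-cubes of side `≤ 1/2`). [folklore] -/
theorem periodicEnergy_hardCore_top_of_le {N M : ℕ} (hN : 64 ≤ N) (hM : N ≤ M) :
    ∀ Ψ : PeriodicTrialState M (sideLength 64 N), periodicEnergy hardCore Ψ = ⊤ := by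
  have hρ : (0 : ℝ) < 64 := by norm_num
  have hL := sideLength_pos_of_pos hρ (by omega : 0 < N)
  have hL3 : sideLength 64 N ^ 3 = (N : ℝ) / 64 := sideLength_pow_three hρ N
  set L := sideLength 64 N with hLdef
  have hNR : (64 : ℝ) ≤ N := by exact_mod_cast hN
  have hL1 : 1 ≤ L := by
    have h1 : (1 : ℝ) ≤ L ^ 3 := by
      rw [hL3, le_div_iff₀ hρ]
      linarith
    by_contra hlt
    push Not at hlt
    have : L ^ 3 < 1 ^ 3 := pow_lt_pow_left₀ hlt hL.le (by norm_num)
    linarith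
  set m : ℕ := ⌈2 * L⌉₊ with hm
  have hm2 : 2 * L ≤ m := Nat.le_ceil _
  have hmlt : (m : ℝ) < 2 * L + 1 := Nat.ceil_lt_add_one (by positivity)
  have hm3L : (m : ℝ) ≤ 3 * L := by linarith
  have hcardR : (m : ℝ) ^ 3 < (N : ℝ) := by
    have h27 : (m : ℝ) ^ 3 ≤ 27 * ((N : ℝ) / 64) := by
      have : (m : ℝ) ^ 3 ≤ (3 * L) ^ 3 := pow_le_pow_left₀ (by positivity) hm3L 3
      rw [mul_pow, hL3] at this
      linarith
    have : 27 * ((N : ℝ) / 64) < N := by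
      rw [mul_div_assoc', div_lt_iff₀ hρ]
      linarith
    linarith
  have hcard : m ^ 3 < M := lt_of_lt_of_le (by exact_mod_cast hcardR) hM
  exact fun Ψ => periodicEnergy_hardCore_eq_top hL hm2 hcard Ψ

/-- `E₀^per(hardCore; M, L_N) = ⊤` for `M ≥ N ≥ 64` at `ρ = 64`. [folklore] -/
theorem periodicGroundStateEnergy_hardCore_top_of_le {N M : ℕ} (hN : 64 ≤ N) (hM : N ≤ M) :
    periodicGroundStateEnergy hardCore M (sideLength 64 N) = ⊤ :=
  iInf_eq_top.2 fun Ψ => periodicEnergy_hardCore_top_of_le hN hM Ψ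

/-- Every momentum sector of the jammed boxes has energy `⊤`. [folklore] -/
theorem momentumSectorEnergy_hardCore_top_of_le {N M : ℕ} (hN : 64 ≤ N) (hM : N ≤ M) (q : Space) :
    momentumSectorEnergy hardCore M (sideLength 64 N) q = ⊤ :=
  top_le_iff.1 ((periodicGroundStateEnergy_hardCore_top_of_le hN hM).symm.le.trans
    (periodicGroundStateEnergy_le_momentumSectorEnergy hardCore M _ q))

/-! ## §3 The density threshold of stub 6b is load-bearing -/

/-- `h e₁` as a Euclidean vector. [folklore] -/
theorem latticeVec_e0 (h : ℝ) : latticeVec h GaussianDominationCan.Negative.e0 = EuclideanSpace.single 0 h := by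
  ext a
  simp only [latticeVec, PiLp.toLp_apply, EuclideanSpace.single, PiLp.single_apply]
  fin_cases a <;>
    simp [GaussianDominationCan.Negative.e0]

/-- `‖h e₁‖ = |h|`. [folklore] -/
theorem norm_latticeVec_e0 (h : ℝ) : ‖latticeVec h GaussianDominationCan.Negative.e0‖ = |h| := by
  rw [latticeVec_e0, EuclideanSpace.single, PiLp.norm_single, Real.norm_eq_abs]

/-- The bottom mode enters every window eventually: `‖2πe₁/L_N‖² ≤ Cρ` for large `N`. [folklore] -/
theorem eventually_bottomMode_window {ρ C : ℝ} (hρ : 0 < ρ) (hC : 0 < C) :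
    ∀ᶠ N : ℕ in atTop, ‖latticeVec (2 * Real.pi / sideLength ρ N) GaussianDominationCan.Negative.e0‖ ^ 2 ≤ C * ρ := by
  have hCρ : 0 < C * ρ := mul_pos hC hρ
  filter_upwards [(tendsto_sideLength_atTop hρ).eventually_ge_atTop
    (max 1 (2 * Real.pi / Real.sqrt (C * ρ)))] with N hN
  have hL1 : 1 ≤ sideLength ρ N := le_trans (le_max_left _ _) hN
  have hL : 0 < sideLength ρ N := by linarith
  have h2 : 2 * Real.pi / Real.sqrt (C * ρ) ≤ sideLength ρ N := le_trans (le_max_right _ _) hN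
  have hsq : 0 < Real.sqrt (C * ρ) := Real.sqrt_pos.2 hCρ
  rw [norm_latticeVec_e0, abs_of_pos (by positivity), div_pow]
  rw [div_le_iff₀ (by positivity)]
  rw [div_le_iff₀ hsq] at h2
  have h3 : (2 * Real.pi) ^ 2 ≤ (sideLength ρ N * Real.sqrt (C * ρ)) ^ 2 :=
    pow_le_pow_left₀ (by positivity) h2 2
  rw [mul_pow (sideLength ρ N), Real.sq_sqrt hCρ.le] at h3
  linarith

/-- **MUTATION (stub 6b `stub_hardCoreWagnerFeynman`): the density threshold is load-bearing.** For the
admissible hard core of radius `1`, `HardCoreWagnerFeynmanWith hardCore C A ρ₁` FAILS for every window constant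
`C > 0`, every moment constant `A` and every threshold `ρ₁ > 64`: at `ρ = 64` and `N ≥ 64` the box
`L_N = (N/64)^{1/3}` is jammed for `N` and for `N + 1` particles, so `2E₀^per(N,L_N) + θ ≤ E^per_{N+1}(p) +
E^per_{N-1}(p)` reads `⊤ ≤ ⊤` for EVERY `θ ≥ 0`, every state is a near-minimiser and the boosted condensate
gives `γ_N(e₁) ≥ N ≥ 1`; the conclusion `γ_N(e₁)·θ ≤ A(‖p‖² + 64)` then fails at
`θ = A(‖p‖² + 64) + 1`. [folklore] -/
theorem not_hardCoreWagnerFeynmanWith_hardCore {C ρ₁ : ℝ} (hC : 0 < C) (hρ₁ : 64 < ρ₁) (A : ℝ) :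
    ¬ HardCoreWagnerFeynmanWith hardCore C A ρ₁ := by
  intro h
  have hρ : (0 : ℝ) < 64 := by norm_num
  obtain ⟨N, hN, hwin, hN64⟩ :=
    ((h 64 hρ hρ₁).and ((eventually_bottomMode_window hρ hC).and (eventually_ge_atTop 64))).exists
  obtain ⟨m, rfl⟩ : ∃ m, N = m + 1 := ⟨N - 1, by omega⟩
  have hL := sideLength_pos_of_pos hρ (by omega : 0 < m + 1)
  set L := sideLength 64 (m + 1) with hLdef
  set p : Space := latticeVec (2 * Real.pi / L) GaussianDominationCan.Negative.e0 with hp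
  -- the jammed energies
  have hE0 : periodicGroundStateEnergy hardCore (m + 1) L = ⊤ :=
    periodicGroundStateEnergy_hardCore_top_of_le hN64 le_rfl
  have hEplus : momentumSectorEnergy hardCore (m + 1 + 1) L p = ⊤ :=
    momentumSectorEnergy_hardCore_top_of_le hN64 (Nat.le_succ _) p
  -- the slack at which the conclusion fails
  set θ : ℝ := A * (‖p‖ ^ 2 + 64) + 1 with hθ
  have hθA : A * (‖p‖ ^ 2 + 64) < θ := by rw [hθ]; linarith
  by_cases hA : A * (‖p‖ ^ 2 + 64) < 0
  · -- negative right-hand side: the bound `ofReal (negative) = 0` already fails at `θ = 1`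
    have key := hN GaussianDominationCan.Negative.e0 e0_ne_zero hwin 1 zero_le_one (by rw [hE0, hEplus, top_add]; exact le_top)
    rw [ENNReal.ofReal_one, mul_one, ENNReal.ofReal_of_nonpos hA.le, nonpos_iff_eq_zero] at key
    have hγ := natCast_le_groundOccupation_of_eq_top (v := hardCore) hL hE0 e0_ne_zero
    rw [key] at hγ
    exact absurd (nonpos_iff_eq_zero.1 hγ) (by exact_mod_cast Nat.succ_ne_zero m)
  · push Not at hA
    have hθ0 : 0 ≤ θ := by linarith
    have key := hN GaussianDominationCan.Negative.e0 e0_ne_zero hwin θ hθ0 (by rw [hE0, hEplus, top_add]; exact le_top)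
    have hγ := natCast_le_groundOccupation_of_eq_top (v := hardCore) hL hE0 e0_ne_zero
    -- `N·θ ≤ γ·θ ≤ A(‖p‖²+64) < θ ≤ N·θ`
    have h1 : ((m + 1 : ℕ) : ℝ≥0∞) * ENNReal.ofReal θ ≤ ENNReal.ofReal (A * (‖p‖ ^ 2 + 64)) :=
      (mul_le_mul' hγ le_rfl).trans key
    have h2 : ENNReal.ofReal θ ≤ ((m + 1 : ℕ) : ℝ≥0∞) * ENNReal.ofReal θ := by
      have : (1 : ℝ≥0∞) ≤ ((m + 1 : ℕ) : ℝ≥0∞) := by exact_mod_cast Nat.succ_pos m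
      calc ENNReal.ofReal θ = 1 * ENNReal.ofReal θ := (one_mul _).symm
        _ ≤ ((m + 1 : ℕ) : ℝ≥0∞) * ENNReal.ofReal θ := mul_le_mul' this le_rfl
    have h3 := (ENNReal.ofReal_le_ofReal_iff hA).1 (h2.trans h1)
    linarith

/-- Hence any valid threshold for the hard core lies at or below close packing: if
`HardCoreWagnerFeynmanWith hardCore C A ρ₁` holds with `C > 0` then `ρ₁ ≤ 64`. [folklore] -/
theorem hardCoreWagnerFeynmanWith_hardCore_threshold_le {C A ρ₁ : ℝ} (hC : 0 < C)
    (h : HardCoreWagnerFeynmanWith hardCore C A ρ₁) : ρ₁ ≤ 64 :=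
  not_lt.1 fun hlt => not_hardCoreWagnerFeynmanWith_hardCore hC hlt A h

/-- `HardCoreWagnerFeynmanBound` with the threshold made uniform (`∀ ρ₁ > 0` in place of `∃ ρ₁ > 0`;
everything else verbatim): the moment bound claimed at ALL densities. -/
def HardCoreWagnerFeynmanAllDensities : Prop :=
  ∀ v : ℝ → ℝ≥0∞, IsRepulsiveFiniteRange v → (∫⁻ x : Space, v ‖x‖) = ⊤ →
    ∀ C : ℝ, 0 < C → ∃ A : ℝ, 0 < A ∧ ∀ ρ₁ : ℝ, 0 < ρ₁ → HardCoreWagnerFeynmanWith v C A ρ₁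

/-- **The hard-core moment bound cannot hold at all densities** (refuted by the admissible hard core of
radius `1` at `ρ = 64`, window constant `C = 1`). [folklore] -/
theorem not_hardCoreWagnerFeynmanAllDensities : ¬ HardCoreWagnerFeynmanAllDensities := by
  intro h
  obtain ⟨A, _hA, hAll⟩ := h hardCore isRepulsiveFiniteRange_hardCore lintegral_hardCore_eq_top 1 one_pos
  exact not_hardCoreWagnerFeynmanWith_hardCore one_pos (by norm_num : (64 : ℝ) < 65) A
    (hAll 65 (by norm_num))

/-- Stub 5b's fixed-box shape transplanted to a NON-integrable `v` (constant `N/L³` in place of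
`N‖v‖₁/L³`, which is void when `∫v = ⊤`) and WITHOUT its guard `E₀^per(N,L) ≠ ⊤`. -/
def HardCoreWagnerFeynmanFixedBox (v : ℝ → ℝ≥0∞) (A : ℝ) : Prop :=
  ∀ (N : ℕ) (L : ℝ), 2 ≤ N → 0 < L → ∀ k : Fin 3 → ℤ, k ≠ 0 → ∀ θ : ℝ, 0 ≤ θ →
    2 * periodicGroundStateEnergy v N L + ENNReal.ofReal θ ≤
        momentumSectorEnergy v (N + 1) L (latticeVec (2 * Real.pi / L) k) +
          momentumSectorEnergy v (N - 1) L (latticeVec (2 * Real.pi / L) k) →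
    groundOccupation v N L k * ENNReal.ofReal θ ≤
      ENNReal.ofReal (A * (‖latticeVec (2 * Real.pi / L) k‖ ^ 2 + N / L ^ 3))

/-- **The unguarded fixed-box moment bound is false for the hard core** (every `A`): in the jammed box
`(N, L_N)`, `ρ = 64`, `N = 64`, the hypothesis is `⊤ ≤ ⊤` and `γ_N(e₁) ≥ N`. So for non-integrable `v` a
fixed-`(N,L)` statement needs the guard `E₀^per ≠ ⊤` (as stub 5b has), and along `L_N` the guard is exactly
the low-density threshold (`exists_eventually_periodicGroundStateEnergy_lt_top`). [folklore] -/
theorem not_hardCoreWagnerFeynmanFixedBox (A : ℝ) : ¬ HardCoreWagnerFeynmanFixedBox hardCore A := by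
  intro h
  have hρ : (0 : ℝ) < 64 := by norm_num
  have hL := sideLength_pos_of_pos hρ (by norm_num : 0 < 63 + 1)
  set L := sideLength 64 (63 + 1) with hLdef
  set p : Space := latticeVec (2 * Real.pi / L) GaussianDominationCan.Negative.e0 with hp
  have hE0 : periodicGroundStateEnergy hardCore (63 + 1) L = ⊤ :=
    periodicGroundStateEnergy_hardCore_top_of_le (by norm_num) le_rfl
  have hEplus : momentumSectorEnergy hardCore (63 + 1 + 1) L p = ⊤ :=
    momentumSectorEnergy_hardCore_top_of_le (by norm_num) (Nat.le_succ _) p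
  have hγ := natCast_le_groundOccupation_of_eq_top (v := hardCore) hL hE0 e0_ne_zero
  set B : ℝ := A * (‖p‖ ^ 2 + (63 + 1 : ℕ) / L ^ 3) with hB
  by_cases hA : B < 0
  · have key := h (63 + 1) L (by norm_num) hL GaussianDominationCan.Negative.e0 e0_ne_zero 1 zero_le_one
      (by rw [hE0, hEplus, top_add]; exact le_top)
    rw [ENNReal.ofReal_one, mul_one, ← hB, ENNReal.ofReal_of_nonpos hA.le, nonpos_iff_eq_zero] at key
    rw [key] at hγ
    exact absurd (nonpos_iff_eq_zero.1 hγ) (by norm_num)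
  · push Not at hA
    set θ : ℝ := B + 1 with hθ
    have hθ0 : 0 ≤ θ := by rw [hθ]; linarith
    have key := h (63 + 1) L (by norm_num) hL GaussianDominationCan.Negative.e0 e0_ne_zero θ hθ0
      (by rw [hE0, hEplus, top_add]; exact le_top)
    rw [← hB] at key
    have h1 : ((63 + 1 : ℕ) : ℝ≥0∞) * ENNReal.ofReal θ ≤ ENNReal.ofReal B :=
      (mul_le_mul' hγ le_rfl).trans key
    have h2 : ENNReal.ofReal θ ≤ ((63 + 1 : ℕ) : ℝ≥0∞) * ENNReal.ofReal θ := by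
      have : (1 : ℝ≥0∞) ≤ ((63 + 1 : ℕ) : ℝ≥0∞) := by norm_num
      calc ENNReal.ofReal θ = 1 * ENNReal.ofReal θ := (one_mul _).symm
        _ ≤ ((63 + 1 : ℕ) : ℝ≥0∞) * ENNReal.ofReal θ := mul_le_mul' this le_rfl
    have h3 := (ENNReal.ofReal_le_ofReal_iff hA).1 (h2.trans h1)
    rw [hθ] at h3
    linarith

/-! ## §4 Normal form of the corner: an infinite channel forces `γ = 0` -/

/-- If `x·θ ≤ B` for every real `θ ≥ 0` (in `ℝ≥0∞`, `B` a fixed real) then `x = 0`. [folklore] -/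
theorem eq_zero_of_forall_mul_ofReal_le {x : ℝ≥0∞} {B : ℝ}
    (h : ∀ θ : ℝ, 0 ≤ θ → x * ENNReal.ofReal θ ≤ ENNReal.ofReal B) : x = 0 := by
  by_contra hx
  rcases eq_or_ne x ⊤ with rfl | hxt
  · have h1 := h 1 zero_le_one
    rw [ENNReal.ofReal_one, mul_one, top_le_iff] at h1
    exact ENNReal.ofReal_ne_top h1
  · have hxpos : 0 < x.toReal := ENNReal.toReal_pos hx hxt
    have hB0 : (0 : ℝ) ≤ max B 0 := le_max_right _ _
    set θ : ℝ := (max B 0 + 1) / x.toReal with hθ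
    have hθ0 : 0 ≤ θ := by positivity
    have h2 := h θ hθ0
    rw [← ENNReal.ofReal_toReal hxt, ← ENNReal.ofReal_mul ENNReal.toReal_nonneg] at h2
    have hprod : x.toReal * θ = max B 0 + 1 := by
      rw [hθ]; field_simp
    rw [hprod] at h2
    have h3 : ENNReal.ofReal (max B 0 + 1) ≤ ENNReal.ofReal (max B 0) :=
      h2.trans (ENNReal.ofReal_le_ofReal (le_max_left _ _))
    have h4 := (ENNReal.ofReal_le_ofReal_iff hB0).1 h3
    linarith

/-- **Corner of stub 6b, made explicit.** Under `HardCoreWagnerFeynmanWith v C A ρ₁`, for `ρ < ρ₁` and eventually in `N`,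
every window mode whose particle OR hole sector at `p = 2πk/L_N` has energy `⊤` must have ground-state occupation ZERO
(the hypothesis then holds for every `θ`). At low density this never fires (finite-energy states inhabit every lattice
sector once `E₀^per(N±1, L_N) < ⊤`), but it is part of what a proof of 6b asserts; at jamming it is what §3 exploits.
[folklore] -/
theorem groundOccupation_eq_zero_of_channel_top {v : ℝ → ℝ≥0∞} {C A ρ₁ ρ : ℝ}
    (h : HardCoreWagnerFeynmanWith v C A ρ₁) (hρ : 0 < ρ) (hρ₁ : ρ < ρ₁) :
    ∀ᶠ N : ℕ in atTop, ∀ k : Fin 3 → ℤ, k ≠ 0 →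
      ‖latticeVec (2 * Real.pi / sideLength ρ N) k‖ ^ 2 ≤ C * ρ →
      (momentumSectorEnergy v (N + 1) (sideLength ρ N) (latticeVec (2 * Real.pi / sideLength ρ N) k) = ⊤ ∨
        momentumSectorEnergy v (N - 1) (sideLength ρ N) (latticeVec (2 * Real.pi / sideLength ρ N) k) = ⊤) →
      groundOccupation v N (sideLength ρ N) k = 0 := by
  filter_upwards [h ρ hρ hρ₁] with N hN k hk hwin htop
  refine eq_zero_of_forall_mul_ofReal_le fun θ hθ => hN k hk hwin θ hθ ?_
  rcases htop with h1 | h1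
  · rw [h1, top_add]; exact le_top
  · rw [h1, add_top]; exact le_top

end HardCoreThreshold

end Summit.AtomisticToContinuum.BoseEinsteinCondensation.Theorems.PeriodicIRBound.Negative

end
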